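import Summits.CriticalPhenomena.PercolationContinuityZ3.Theorems.SahiConjecture
import HarnessLib

/-!
# `NoHeavyLowerTail` (stmt-CriticalPhenomena-4575) — the hybrid group-separation Richards–Sahi rows of the
# SHK3⁺ terminal-edge step, stated at MEASURE level (P1 coupling line, cell `prim-l12`)

Support file (`--supports stmt-CriticalPhenomena-4575`).  STATEMENTS FIRST (cell rule): the targets of the
three-copy switching / disjoint-witness coupling line are recorded here as named `Prop`s, in the tree's
vocabulary (`sahiE3`, `prodBernoulli`, `openConn`); no new mathematical notion is introduced.

Setting: Bernoulli bond percolation `μ = prodBernoulli w` on a finite vertex type `V`, four marked vertices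
`a b c y` (`{a,y}` = the apex edge being added in the terminal-edge induction of
`…CubicThreePointBernsteinStep` / `…CubicThreePointPolarization`).  Decreasing events:
`D_bc = {b ↮ c}`, `D_ac = {a ↮ c}`, `D_ab = {a ↮ b}`, and the GROUP separations
`G_ab = D[ay|b] = {b ↮ a} ∩ {b ↮ y}`, `G_ac = D[ay|c] = {c ↮ a} ∩ {c ↮ y}`,
`G_bc = D_bc ∖ {ab|cy, ac|by} = {b ↮ c} ∩ ({b ↔ a} ∩ {c ↔ y})ᶜ ∩ ({b ↔ y} ∩ {c ↔ a})ᶜ` ("`b ↮ c` after gluing `a = y`").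

* `HybridSepRow` — **(E1)** `0 ≤ E₃(D_bc, D_ac, G_ab)` for all finite weighted graphs and all `a b c y`.
  By the `b ↔ c` relabelling the same `Prop` contains the mirror row (E2) `0 ≤ E₃(D_bc, G_ac, D_ab)`.
  This is the ONE hybrid Richards–Sahi cubic the slice certificate `CubicThreePointStep.bernstein_nonneg_slice`
  consumes (`hybE ≥ 0`); an instance of Kahn's Conjecture 5 / Sahi `C_3` with one group-separation slot
  (`hybridSepRow_of_kahnConjecture`).  Census: 0 violations / 3 134 940 exact instances (ttrl2 bern4, line 400).
* `PolarisedRowL1` — **(L1)** `μ(a|bcy)·μ(b ↮ c) ≤ E₃(D_bc,D_ac,G_ab) + E₃(D_bc,G_ac,D_ab)`, the polarised form of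
  the first Bernstein piece (`threeB₁ = (L1-slack) + F(x⁰) + (β₁+β₂)·H(D_ab,D_ac)`, `threeB₁_polarization`).
* `PolarisedRowL2` — **(L2)** `μ(a|bcy)·μ(G_bc) ≤ E₃(D_bc,G_ac,G_ab) + E₃(D_bc,D_ac,G_ab) + E₃(D_bc,G_ac,D_ab)`
  (`threeB₂ = (L2-slack) + (β₁+β₂)·Harris`, `threeB₂_polarization`).
Here `μ(a|bcy) = μ({a ↮ b} ∩ {b ↔ c} ∩ {b ↔ y})` (the cell "`a` isolated, `b,c,y` one cluster").
(L1), (L2): 0 violations / 3 134 940 exact instances + 26.5 M composed laws, minimum ratio exactly `1` on the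
cut-vertex face (ttrl2 bern4 README 'POLARIZATION L1/L2').  All three are OPEN; proofs are the business of the
companion certificate files of this line.  Nothing here is used as a hypothesis elsewhere except by name.
-/

noncomputable section

namespace Summit.CriticalPhenomena.PercolationContinuityZ3.Theorems

open MeasureTheory
open Literature.Probability.LatticeModels (prodBernoulli sahiE3)
open Literature.Probability.Percolation
open Literature.Combinatorics.Sahi2008 (isLowerSet_compl_openConn)

/-- **(E1) the hybrid group-separation row** of the SHK3⁺ terminal-edge step: for every finite weighted graph and
vertices `a b c y`, `0 ≤ E₃({b ↮ c}, {a ↮ c}, {b ↮ a} ∩ {b ↮ y})` (Sahi's third-order functional of three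
decreasing events, the third a group separation `D[ay|b]`).  An instance of Kahn's Conjecture 5 /
Sahi's `C_3` for product measures; OPEN (obligation of the P1 coupling line; census 0 / 3 134 940).
[cite: Kahn2022, Conj. 5 (arXiv p. 3)] [status: open] -/
@[conjecture] def HybridSepRow : Prop :=
  ∀ (V : Type) [Fintype V] (w : Sym2 V → unitInterval) (a b c y : V),
    0 ≤ sahiE3 (prodBernoulli w) (openConn b c)ᶜ (openConn a c)ᶜ ((openConn b a)ᶜ ∩ (openConn b y)ᶜ)

/-- **(L1) the polarised first Bernstein piece**: `μ({a↮b} ∩ {b↔c} ∩ {b↔y}) · μ({b↮c}) ≤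
E₃(D_bc, D_ac, D[ay|b]) + E₃(D_bc, D[ay|c], D_ab)` for every finite weighted graph and `a b c y`.  OPEN
(conjectured in this programme — polarisation of the SHK3⁺ Bernstein piece along a terminal edge, cf. the
coordinate induction of [GladkovZimin2024HK, §4]; census-validated, tight exactly on the cut-vertex face).
[cite: GladkovZimin2024HK, §4 (coordinate induction; the inequality itself is ours)] [status: open] -/
@[conjecture] def PolarisedRowL1 : Prop :=
  ∀ (V : Type) [Fintype V] (w : Sym2 V → unitInterval) (a b c y : V),
    (prodBernoulli w).real ((openConn a b)ᶜ ∩ (openConn b c ∩ openConn b y)) *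
        (prodBernoulli w).real (openConn b c)ᶜ ≤
      sahiE3 (prodBernoulli w) (openConn b c)ᶜ (openConn a c)ᶜ ((openConn b a)ᶜ ∩ (openConn b y)ᶜ) +
        sahiE3 (prodBernoulli w) (openConn b c)ᶜ ((openConn c a)ᶜ ∩ (openConn c y)ᶜ) (openConn a b)ᶜ

/-- **(L2) the polarised second Bernstein piece**: with `G_bc = {b↮c} ∩ ({b↔a} ∩ {c↔y})ᶜ ∩ ({b↔y} ∩ {c↔a})ᶜ`
("`b ↮ c` in the graph with `a, y` glued"),
`μ({a↮b} ∩ {b↔c} ∩ {b↔y}) · μ(G_bc) ≤ E₃(D_bc, D[ay|c], D[ay|b]) + E₃(D_bc, D_ac, D[ay|b]) + E₃(D_bc, D[ay|c], D_ab)`.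
OPEN (conjectured in this programme; census-validated).
[cite: GladkovZimin2024HK, §4 (coordinate induction; the inequality itself is ours)] [status: open] -/
@[conjecture] def PolarisedRowL2 : Prop :=
  ∀ (V : Type) [Fintype V] (w : Sym2 V → unitInterval) (a b c y : V),
    (prodBernoulli w).real ((openConn a b)ᶜ ∩ (openConn b c ∩ openConn b y)) *
        (prodBernoulli w).real
          ((openConn b c)ᶜ ∩ (openConn b a ∩ openConn c y)ᶜ ∩ (openConn b y ∩ openConn c a)ᶜ) ≤
      sahiE3 (prodBernoulli w) (openConn b c)ᶜ ((openConn c a)ᶜ ∩ (openConn c y)ᶜ)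
          ((openConn b a)ᶜ ∩ (openConn b y)ᶜ) +
        sahiE3 (prodBernoulli w) (openConn b c)ᶜ (openConn a c)ᶜ ((openConn b a)ᶜ ∩ (openConn b y)ᶜ) +
        sahiE3 (prodBernoulli w) (openConn b c)ᶜ ((openConn c a)ᶜ ∩ (openConn c y)ᶜ) (openConn a b)ᶜ

/-- **Kahn's Conjecture 5 ⇒ (E1)**: the hybrid row is an instance of `C_3` for product measures (three
decreasing events). [cite: Kahn2022, Conj. 5 (arXiv p. 3)] -/
theorem hybridSepRow_of_kahnConjecture (hK : KahnConjecture) : HybridSepRow := by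
  intro V _ w a b c y
  exact sahiE3_nonneg_of_kahnConjecture_lower hK w (isLowerSet_compl_openConn b c)
    (isLowerSet_compl_openConn a c) ((isLowerSet_compl_openConn b a).inter (isLowerSet_compl_openConn b y))

end Summit.CriticalPhenomena.PercolationContinuityZ3.Theorems
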